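import HarnessLib
import Summits.RiemannHypothesis.RiemannHypothesis.Theorems.SignConePointwiseCertOneData

/-!
# Route SignCone: pointwise certificate `pwCert1` — grid chunks 36–37

Support for the unconditional rungs of `SignConeOscillatory` / `SignConeInequality`
(items stmt-RiemannHypothesis-16302 / 16301). Grid chunks of the certificate `pwCert1`
(`SignConePointwiseCertOneData.lean`) and the kernel evaluation of their cells (`PWData.checkGrid`,
`SignConePointwiseCheckerSound.lean`; `decide +kernel`, about half a minute each).
-/

-- `Summit.RiemannHypothesis.RiemannHypothesis.…` repeats a namespace component by design (D-0017 layout).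
set_option linter.dupNamespace false

noncomputable section

namespace Summit.RiemannHypothesis.RiemannHypothesis.Theorems.SignCone

open Literature.Analysis.ValidatedNumerics.Numerics

/-- Grid chunk 36 of the certificate `pwCert1` (`60` cells on `[60.2595, 65.0066]`). [folklore] -/
def pwCert1Grid36 : List ℚ :=
  [
    246823/4096, 247391/4096, 247957/4096, 3883/64, 249049/4096, 62391/1024, 250055/4096, 31315/512, 15685/256, 251377/4096, 251773/4096, 252149/4096,
    252509/4096, 126427/2048, 126593/2048, 253507/4096, 253819/4096, 63531/1024, 254423/4096, 63679/1024, 255005/4096, 255291/4096, 127787/2048, 255855/4096,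
    128067/2048, 64103/1024, 256689/4096, 256965/4096, 32155/512, 128757/2048, 257787/4096, 258059/4096, 129165/2048, 258599/4096, 258867/4096, 259133/4096,
    129699/2048, 259661/4096, 259923/4096, 260183/4096, 130221/2048, 260699/4096, 65239/1024, 65303/1024, 65367/1024, 261725/4096, 261983/4096, 262243/4096,
    262505/4096, 262771/4096, 263041/4096, 65829/1024, 131799/2048, 16493/256, 264187/4096, 264497/4096, 264819/4096, 265155/4096, 265507/4096, 265877/4096,
    266267/4096]


set_option maxHeartbeats 0 in
/-- **Kernel check of grid chunk 36.** [folklore] -/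
theorem pwCert1_grid36 : pwCert1.checkGrid pwCert1Grid36 = true := by
  decide +kernel

/-- Grid chunk 37 of the certificate `pwCert1` (`54` cells on `[65.0066, 70.0000]`). [folklore] -/
def pwCert1Grid37 : List ℚ :=
  [
    266267/4096, 133339/2048, 267111/4096, 267567/4096, 268045/4096, 1049/16, 134531/2048, 269593/4096, 67533/1024, 16917/256, 271205/4096, 67931/1024,
    136111/2048, 34087/512, 273143/4096, 136781/2048, 273953/4096, 137159/2048, 68665/1024, 68745/1024, 137641/2048, 275567/4096, 275839/4096, 276099/4096,
    138175/2048, 276593/4096, 138415/2048, 34633/512, 277295/4096, 138763/2048, 277757/4096, 277991/4096, 278229/4096, 278473/4096, 69681/1024, 34873/512,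
    34907/512, 279541/4096, 279841/4096, 280159/4096, 280497/4096, 280857/4096, 281241/4096, 140825/2048, 141043/2048, 70637/1024, 283035/4096, 283543/4096,
    71017/1024, 142301/2048, 142569/2048, 285669/4096, 286187/4096, 143343/2048, 70]

set_option maxHeartbeats 0 in
/-- **Kernel check of grid chunk 37.** [folklore] -/
theorem pwCert1_grid37 : pwCert1.checkGrid pwCert1Grid37 = true := by
  decide +kernel


end Summit.RiemannHypothesis.RiemannHypothesis.Theorems.SignCone

end
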